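import Summits.QuantumFields.YangMills.Theorems.VirialFluxGapSharpTwistedLaplaceQuantitativeLaplaceGauss
import Mathlib.MeasureTheory.Group.Integral
import HarnessLib

/-!
# Route `SwapVirialDeficit` (YangMills): THE GAUSSIAN INTEGRAL OF A SHIFTED QUADRATIC — completing the square
# (cell ym-idea-1, skeleton ➎; generic brick of w2 g60's memo3 §6 (TIP SIDE) for `stub_core_tip`: the follower integral over a fibre `f ↦ Q(ℓ + f)` is a shifted Gaussian whose
# value is `e^{−min/2}(2π)^{d/2}/√det A_F`, and `min ≥ Floor_L(ℓ)`; free-hands support of ⟨stmt-QuantumFields-24197⟩ `SwapVirialDeficit.SwapGluedStiffness`)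

For a symmetric coercive `A` on a finite-dimensional real inner product space, `b ∈ V`, `c ∈ ℝ` and the critical point `f⋆` (`A f⋆ = −b`, which exists):
* `exists_quadratic_critical` — `∃ f⋆, A f⋆ = −b`;
* `quadratic_complete_square` — `⟪Af,f⟫ + 2⟪b,f⟫ + c = ⟪A(f − f⋆), f − f⋆⟫ + (c − ⟪Af⋆, f⋆⟫)`; `quadratic_ge_min` — the constant is a lower bound;
* ★★ `integral_exp_neg_half_quadratic` — `∫ e^{−½(⟪Af,f⟫ + 2⟪b,f⟫ + c)} df = e^{−½(c − ⟪Af⋆,f⋆⟫)}·(2π)^{d/2}/√det A` (translation invariance + ✓`integral_exp_neg_mul_half_inner`);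
* ★ `integral_exp_neg_half_quadratic_le` — if the quadratic is `≥ m` everywhere then `∫ e^{−½(…)} ≤ e^{−m/2}(2π)^{d/2}/√det A`.

HONEST LABEL: generic Gaussian calculus; `stub_core_tip` and the other stubs, ⟨24197⟩ ∕ ⟨24194⟩ OPEN; own crux ⟨22884⟩ `LargeFieldMassRefinementTail` OPEN (blocked-on ⟨19935⟩); the
Yang–Mills mass gap is NOT proved; no summit is proved by a line.  THEOREMS ONLY (0 `def`, 0 `sorry`), standard axioms.  Width seat ym-line-sfw-p2-w2 g60 (cell ym-idea-1,
free hands), `--supports stmt-QuantumFields-24197`.  References: [cite: Breitung1994, Lemma 26]; [folklore].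
-/

set_option autoImplicit false

noncomputable section

open MeasureTheory Module
open scoped InnerProductSpace

namespace Summit.QuantumFields.YangMills.Theorems.QuantitativeLaplace

variable {V : Type*} [NormedAddCommGroup V] [InnerProductSpace ℝ V] [FiniteDimensional ℝ V] [MeasurableSpace V] [BorelSpace V]

omit [MeasurableSpace V] [BorelSpace V] in
/-- A coercive linear map on a finite-dimensional space is surjective: the critical point `f⋆` of the quadratic, `A f⋆ = −b`, exists. [folklore] -/
theorem exists_quadratic_critical {A : V →ₗ[ℝ] V} {lam : ℝ} (hlam : 0 < lam) (hcoer : ∀ y : V, lam * ‖y‖ ^ 2 ≤ ⟪A y, y⟫_ℝ) (b : V) : ∃ fs : V, A fs = -b := by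
  have hinj : Function.Injective A := by
    intro y y' h
    have h0 : A (y - y') = 0 := by rw [map_sub, h, sub_self]
    have hc := hcoer (y - y')
    rw [h0, inner_zero_left] at hc
    have hn : ‖y - y'‖ ^ 2 ≤ 0 := by
      by_contra hne
      rw [not_le] at hne
      nlinarith
    have : ‖y - y'‖ = 0 := by nlinarith [norm_nonneg (y - y'), sq_nonneg ‖y - y'‖]
    exact sub_eq_zero.1 (norm_eq_zero.1 this)
  have hsurj : Function.Surjective A := LinearMap.surjective_of_injective hinj
  exact hsurj (-b)

omit [FiniteDimensional ℝ V] [MeasurableSpace V] [BorelSpace V] in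
/-- **Completing the square**: with `A f⋆ = −b` and `A` symmetric, `⟪Af,f⟫ + 2⟪b,f⟫ + c = ⟪A(f − f⋆), f − f⋆⟫ + (c − ⟪Af⋆, f⋆⟫)`. [folklore] -/
theorem quadratic_complete_square {A : V →ₗ[ℝ] V} (hA : A.IsSymmetric) {b fs : V} (hfs : A fs = -b) (c : ℝ) (f : V) :
    ⟪A f, f⟫_ℝ + 2 * ⟪b, f⟫_ℝ + c = ⟪A (f - fs), f - fs⟫_ℝ + (c - ⟪A fs, fs⟫_ℝ) := by
  have hb : ⟪b, f⟫_ℝ = -⟪A fs, f⟫_ℝ := by rw [hfs, inner_neg_left, neg_neg]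
  have hsym : ⟪A f, fs⟫_ℝ = ⟪A fs, f⟫_ℝ := by rw [hA f fs, real_inner_comm]
  rw [map_sub, inner_sub_left, inner_sub_right, inner_sub_right, hb, hsym]
  ring

omit [FiniteDimensional ℝ V] [MeasurableSpace V] [BorelSpace V] in
/-- The completed square bounds the quadratic below by its critical value: `c − ⟪Af⋆,f⋆⟫ ≤ ⟪Af,f⟫ + 2⟪b,f⟫ + c` (`A ≥ 0`). [folklore] -/
theorem quadratic_ge_min {A : V →ₗ[ℝ] V} (hA : A.IsSymmetric) (hpsd : ∀ y : V, 0 ≤ ⟪A y, y⟫_ℝ) {b fs : V} (hfs : A fs = -b) (c : ℝ) (f : V) :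
    c - ⟪A fs, fs⟫_ℝ ≤ ⟪A f, f⟫_ℝ + 2 * ⟪b, f⟫_ℝ + c := by
  rw [quadratic_complete_square hA hfs c f]
  have := hpsd (f - fs)
  linarith

/-- ★★ **THE GAUSSIAN INTEGRAL OF A SHIFTED QUADRATIC**: for symmetric `λ`-coercive `A` (`λ > 0`), `A f⋆ = −b`:
`∫ e^{−½(⟪Af,f⟫ + 2⟪b,f⟫ + c)} df = e^{−½(c − ⟪Af⋆,f⋆⟫)}·(2π)^{d∕2}∕√det A`, `d = dim V`. [cite: Breitung1994, Lemma 26] -/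
theorem integral_exp_neg_half_quadratic {A : V →ₗ[ℝ] V} (hA : A.IsSymmetric) {lam : ℝ} (hlam : 0 < lam) (hcoer : ∀ y : V, lam * ‖y‖ ^ 2 ≤ ⟪A y, y⟫_ℝ)
    {b fs : V} (hfs : A fs = -b) (c : ℝ) :
    ∫ f : V, Real.exp (-((1 / 2) * (⟪A f, f⟫_ℝ + 2 * ⟪b, f⟫_ℝ + c))) =
      Real.exp (-((1 / 2) * (c - ⟪A fs, fs⟫_ℝ))) * ((2 * Real.pi) ^ ((finrank ℝ V : ℝ) / 2) / Real.sqrt (LinearMap.det A)) := by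
  have e : (fun f : V => Real.exp (-((1 / 2) * (⟪A f, f⟫_ℝ + 2 * ⟪b, f⟫_ℝ + c)))) =
      fun f => Real.exp (-((1 / 2) * (c - ⟪A fs, fs⟫_ℝ))) * (fun g : V => Real.exp (-(1 * ((1 / 2) * ⟪A g, g⟫_ℝ)))) (f - fs) := by
    funext f
    rw [quadratic_complete_square hA hfs c f, ← Real.exp_add]
    congr 1; ring
  rw [e, MeasureTheory.integral_const_mul, integral_sub_right_eq_self (fun g : V => Real.exp (-(1 * ((1 / 2) * ⟪A g, g⟫_ℝ)))) fs,
    integral_exp_neg_mul_half_inner hA hlam hcoer one_pos, div_one]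

/-- ★ **UPPER BOUND BY ANY LOWER BOUND OF THE QUADRATIC**: if `m ≤ ⟪Af,f⟫ + 2⟪b,f⟫ + c` for all `f`, then `∫ e^{−½(…)} ≤ e^{−m∕2}·(2π)^{d∕2}∕√det A`
(the fibre integral over the followers is controlled by any floor of the fibre minimum — memo3 §6). [cite: Breitung1994, Lemma 26] -/
theorem integral_exp_neg_half_quadratic_le {A : V →ₗ[ℝ] V} (hA : A.IsSymmetric) {lam : ℝ} (hlam : 0 < lam) (hcoer : ∀ y : V, lam * ‖y‖ ^ 2 ≤ ⟪A y, y⟫_ℝ)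
    (b : V) (c : ℝ) {m : ℝ} (hm : ∀ f : V, m ≤ ⟪A f, f⟫_ℝ + 2 * ⟪b, f⟫_ℝ + c) :
    ∫ f : V, Real.exp (-((1 / 2) * (⟪A f, f⟫_ℝ + 2 * ⟪b, f⟫_ℝ + c))) ≤
      Real.exp (-(m / 2)) * ((2 * Real.pi) ^ ((finrank ℝ V : ℝ) / 2) / Real.sqrt (LinearMap.det A)) := by
  obtain ⟨fs, hfs⟩ := exists_quadratic_critical hlam hcoer b
  rw [integral_exp_neg_half_quadratic hA hlam hcoer hfs c]
  have hdet : 0 < LinearMap.det A := Literature.Analysis.Asymptotics.det_pos_of_inner_pos hA (inner_pos_of_coercive hlam hcoer)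
  have hK : 0 ≤ (2 * Real.pi) ^ ((finrank ℝ V : ℝ) / 2) / Real.sqrt (LinearMap.det A) := by positivity
  refine mul_le_mul_of_nonneg_right (Real.exp_le_exp.2 ?_) hK
  -- the critical value is the minimum: take `f = f⋆`
  have h := hm fs
  rw [quadratic_complete_square hA hfs c fs, sub_self, map_zero, inner_zero_left, zero_add] at h
  linarith

end Summit.QuantumFields.YangMills.Theorems.QuantitativeLaplace

end
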